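/-
Copyright: the b2b-balaban T⁴-continuum CRUX team, row NE7b OWNER lineage `t4-ne7b-p1` (gen 123). Project licence.
-/
import Summits.QuantumFields.BalabanUV.T4Continuum.Spine.NE7b.SupZdPropagatorUniqueness
import Summits.QuantumFields.BalabanUV.T4Continuum.Spine.NE7b.SupTorusGradientRoad

/-!
# THE `ℤ^d` COLUMN INHERITS THE TORUS LETTERS BY NAME: for every `V : ℤ^d → [−λ, Λ]`, `d ≥ 3`, every mesh, EVERY bounded solution of
# `H_V u = f` on `ℤ^d` (`|f| ≤ M`) has the block-scale GRADIENT bound `(n+1)|u(p + ê_μ) − u(p)| ≤ C·M` ((156) §2 through the tower), the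
# DECAYING gradient `e^{δ|blk n p − b₀|₁}(n+1)|u(p + ê_μ) − u(p)| ≤ C·M` for block sources ((156) §3), and the bounded propagator is
# `ℓ^∞`-LIPSCHITZ IN THE POTENTIAL, `|u₁ − u₂| ≤ C·‖V₁ − V₂‖_∞·‖f‖_∞` ((180) + (181)) — uniqueness identifies any bounded solution with the
# tower limit, along which the mesh- and volume-free torus letters pass to the limit (row NE7b, node U5c; (152)∕(156)∕(180)∕(181) BY NAME;
# [folklore])

Cell `pub-balaban`, sub-cell `t4`, spine estimate NE7b (`T4WeightBudget.RelWeightBound`; the cell's OWN estimate — NOT PRINTED in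
[Bałaban 1983–89], NOT PROVED).  Crux-route work under `Spine/NE7b/` by the row OWNER (`t4-ne7b-p1` gen 123, file (184)) under FREEZE
(0)'s crux-prover clause; NOTHING of Bałaban's is named as a Lean object, valued or asserted; no `T4Continuum/Support` leaf typed; no `def`,
no notation (the `ℤ^d` operator DISPLAYED); zero `sorry`.  Imports (BY NAME): the OWNER's (181) `…SupZdPropagatorUniqueness`
(`zd_bounded_solution_unique`; through it (180) `tower_limit`, `zd_solution_exists`, `torusDist_eq_l1_of_lt`, (152) `supNorm_bound_road`,
(148) `action_surjective`, TDF `blockOf_siteOf`), (156) `…SupTorusGradientRoad` (`gradient_bound_road`, `gradient_decay_road`).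

WHY (located).  (180)–(183) give the infinite-volume propagator of the road's class as an object (existence, uniqueness in `ℓ^∞`, decay,
symmetry, Lipschitz in the decay currency).  The remaining letters of the torus column transfer by one mechanism: a bounded `ℤ^d` solution
IS the tower limit `lim_k u_k∘σ_k` ((181)), every torus letter holds at every level with mesh- and volume-free constants, and finite
combinations of values (`u_k(σ_k(p + ê_μ)) − u_k(σ_k p)`, with `σ_k(p + ê_μ) = σ_k p + σ_k ê_μ`) converge — so the letter holds in the limit
(`le_of_tendsto`), the torus distance reading the `ℓ¹` distance beyond the window radius.

WHAT IS PROVED ([folklore]; `X d = ℤ^d`; the `ℤ^d` operator `(H_V u)(p) = (n+1)²Σ_μ(2u p − u(p + ê_μ) − u(p − ê_μ)) + a(n+1)^{−d}Σ_{q ∈ B n (blk n p)}u q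
+ V p·u p` DISPLAYED; throughout `d ≥ 3`, `a > 0`, `λ < min(2,a)`, `Λ ≥ 0`, constants from `(d, a, λ, Λ)` and `C(d)` only):
* §1 `bounded_solution_is_tower_limit` (a bounded `ℤ^d` solution is the pointwise limit of ANY family of torus solutions with the window data).
* §2 **`zd_gradient_bound`** (`∃ C > 0`: ALL `n`, `V : ℤ^d → [−λ, Λ]`, `|f| ≤ M`, every BOUNDED solution `u`, `p, μ`: `(n+1)|u(p + ê_μ) − u p| ≤ C·M`);
  **`zd_gradient_decay`** (`∃ C δ > 0`: … `f` supported in the block `b₀`: `e^{δΣ_i|blk n p i − b₀ i|}·(n+1)|u(p + ê_μ) − u p| ≤ C·M`).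
* §3 **`zd_solution_lipschitz_potential`** (`∃ C > 0`: ALL `n`, `V₁, V₂ : ℤ^d → [−λ, Λ]`, `|V₁ − V₂| ≤ D`, `|f| ≤ M`, BOUNDED `u₁, u₂` with
  `H_{V₁}u₁ = f = H_{V₂}u₂`: `|u₁ p − u₂ p| ≤ C·D·M`).
* §4 toy (`d = 3`).

HONEST (what this is NOT).  The LINEAR column only; `d ≥ 3` only; first differences only; constants existential and far from sharp;
scalar skeleton ((A3), NC-NE7b-α UNRULED); nothing of the covariant propagators of [B4]–[B6]; nothing of Bałaban's.  BY-NAME EFFECT ON THE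
WALL: NONE.  NE7b NOT PRINTED ∕ NOT PROVED; spine PROVED 0∕9; rung (B)+1 — the programme's measures remain FINITE-torus statements; NOT the
mass gap, NOT Clay.  HONEST DEPENDENCY: continuum YM on T⁴ ⇐ BetaPertH ∧ nine spine estimates (0∕9 proved); BetaPertH ⇐ (D1) ∧ (D4) ∧
CAP+tail; G-an2-4 gates asym, D1 and NE2∕3∕4.
-/

set_option autoImplicit false

noncomputable section

namespace Summit.QuantumFields.BalabanUV.T4Continuum.NE7b.SupZdPropagatorRegularity

open Real Filter Topology
open Literature.MathematicalPhysics.QuantumFieldTheory.Balaban1983to89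
open B6QGQLower276 (X e blk B side side_facts chart mem_B sum_B sum_B_const card_cube blk_chart)
open Beta (Site siteOf windowMap siteOf_windowMap siteOf_add siteOf_sub)
open SupTorusDirichletForm (blockOf_siteOf)
open SupTorusSupNormBound (action_surjective)
open SupTorusSupNormRoad (supNorm_bound_road)
open SupTorusGradientRoad (gradient_bound_road gradient_decay_road)
open SupZdPropagatorLimit (tower_limit zd_solution_exists torusDist_eq_l1_of_lt)
open SupZdPropagatorUniqueness (zd_bounded_solution_unique)

variable {d : ℕ}

/-! ## §1. A bounded `ℤ^d` solution is the tower limit -/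

/-- **A BOUNDED `ℤ^d` SOLUTION IS THE POINTWISE LIMIT OF THE TORUS SOLUTIONS WITH THE WINDOW DATA** (any family of them): (180) `tower_limit`
gives a limit solution, bounded by (152), and (181) identifies it with the given one. [folklore] -/
theorem bounded_solution_is_tower_limit (hd : 3 ≤ d) (a : ℝ) (ha : 0 < a) {lam Lam : ℝ} (hlam : lam < min 2 a) (hLam : 0 ≤ Lam)
    (n : ℕ) (V : X d → ℝ) (hV : ∀ p, -lam ≤ V p) (hV' : ∀ p, V p ≤ Lam) {M : ℝ} (f : X d → ℝ) (hfM : ∀ p, |f p| ≤ M)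
    (u : X d → ℝ) {Bu : ℝ} (huB : ∀ p, |u p| ≤ Bu)
    (hu : ∀ p, ((n : ℝ) + 1) ^ 2 * ∑ μ, (2 * u p - u (p + e μ) - u (p - e μ))
      + a / ((n : ℝ) + 1) ^ d * ∑ q ∈ B n (blk n p), u q + V p * u p = f p)
    (useq : (k : ℕ) → Site d ((n + 1) * 3 ^ k) → ℝ)
    (husol : ∀ (k : ℕ) (x : Site d ((n + 1) * 3 ^ k)),
      ((n : ℝ) + 1) ^ 2 * ∑ μ, (2 * useq k x - useq k (x + siteOf d ((n + 1) * 3 ^ k) (e μ)) - useq k (x - siteOf d ((n + 1) * 3 ^ k) (e μ)))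
        + a / ((n : ℝ) + 1) ^ d * ∑ q ∈ B n (blk n (windowMap d ((n + 1) * 3 ^ k) x)), useq k (siteOf d ((n + 1) * 3 ^ k) q)
        + V (windowMap d ((n + 1) * 3 ^ k) x) * useq k x = f (windowMap d ((n + 1) * 3 ^ k) x)) :
    ∀ p, Tendsto (fun k => useq k (siteOf d ((n + 1) * 3 ^ k) p)) atTop (𝓝 (u p)) := by
  classical
  obtain ⟨C₀, hC₀, H152⟩ := supNorm_bound_road (d := d) hd a ha hlam hLam
  obtain ⟨v, hveq, hlim⟩ := tower_limit hd a ha hlam hLam n V hV hV' f hfM useq husol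
  have hvB : ∀ p, |v p| ≤ C₀ * M := fun p =>
    le_of_tendsto (hlim p).abs (Filter.Eventually.of_forall fun k =>
      H152 n (3 ^ k) (fun x => V (windowMap d ((n + 1) * 3 ^ k) x)) (fun x => hV _) (fun x => hV' _) M (useq k)
        (fun x => f (windowMap d ((n + 1) * 3 ^ k) x)) (fun x => hfM _) (husol k) _)
  have huv : u = v := zd_bounded_solution_unique hd a ha hlam hLam n V hV hV' f u v huB hvB hu hveq
  rw [huv]; exact hlim

/-! ## §2. The block-scale gradient of bounded `ℤ^d` solutions -/

/-- **HEADLINE (gradient) — `(n+1)·|u(p + ê_μ) − u(p)| ≤ C·‖f‖_∞` FOR EVERY BOUNDED SOLUTION OF `H_V u = f` ON `ℤ^d`**, every `V : ℤ^d → [−λ, Λ]`,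
`d ≥ 3`, every mesh: (156) `gradient_bound_road` at every level of the tower (`σ_k(p + ê_μ) = σ_k p + σ_k ê_μ`), §1, and the limit. [folklore] -/
theorem zd_gradient_bound (hd : 3 ≤ d) (a : ℝ) (ha : 0 < a) {lam Lam : ℝ} (hlam : lam < min 2 a) (hLam : 0 ≤ Lam) :
    ∃ C : ℝ, 0 < C ∧ ∀ (n : ℕ) (V : X d → ℝ), (∀ p, -lam ≤ V p) → (∀ p, V p ≤ Lam) →
      ∀ (M : ℝ) (f : X d → ℝ), (∀ p, |f p| ≤ M) → ∀ (u : X d → ℝ) (Bu : ℝ), (∀ p, |u p| ≤ Bu) →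
      (∀ p, ((n : ℝ) + 1) ^ 2 * ∑ μ, (2 * u p - u (p + e μ) - u (p - e μ))
        + a / ((n : ℝ) + 1) ^ d * ∑ q ∈ B n (blk n p), u q + V p * u p = f p) →
      ∀ (p : X d) (μ : Fin d), ((n : ℝ) + 1) * |u (p + e μ) - u p| ≤ C * M := by
  classical
  obtain ⟨C, hC, H156⟩ := gradient_bound_road (d := d) hd a ha hlam hLam
  refine ⟨C, hC, ?_⟩
  intro n V hV hV' M f hfM u Bu huB hu p μ
  have hm0 : 0 < min 2 a - lam := by linarith
  choose useq husol using fun k : ℕ => action_surjective n a (3 ^ k) ha.le hm0 (fun x => V (windowMap d ((n + 1) * 3 ^ k) x))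
    (fun x => hV _) (fun x => f (windowMap d ((n + 1) * 3 ^ k) x))
  have hlim := bounded_solution_is_tower_limit hd a ha hlam hLam n V hV hV' f hfM u huB hu useq husol
  have hk : ∀ k : ℕ, ((n : ℝ) + 1) * |useq k (siteOf d ((n + 1) * 3 ^ k) (p + e μ)) - useq k (siteOf d ((n + 1) * 3 ^ k) p)| ≤ C * M := by
    intro k
    rw [siteOf_add]
    exact H156 n (3 ^ k) (fun x => V (windowMap d ((n + 1) * 3 ^ k) x)) (fun x => hV _) (fun x => hV' _) M (useq k)
      (fun x => f (windowMap d ((n + 1) * 3 ^ k) x)) (fun x => hfM _) (husol k) _ μ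
  exact le_of_tendsto (((hlim (p + e μ)).sub (hlim p)).abs.const_mul _) (Filter.Eventually.of_forall hk)

/-- **HEADLINE (decaying gradient) — `e^{δΣ_i|blk n p i − b₀ i|}·(n+1)·|u(p + ê_μ) − u(p)| ≤ C·‖f‖_∞`** for every bounded solution of `H_V u = f`
on `ℤ^d` with `f` supported in the block `b₀`, every `V : ℤ^d → [−λ, Λ]`, `d ≥ 3`, every mesh: (156) `gradient_decay_road` at every level,
§1, the torus distance reading the `ℓ¹` distance beyond the window radius, and the limit. [folklore] -/
theorem zd_gradient_decay (hd : 3 ≤ d) (a : ℝ) (ha : 0 < a) {lam Lam : ℝ} (hlam : lam < min 2 a) (hLam : 0 ≤ Lam) :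
    ∃ C δ : ℝ, 0 < C ∧ 0 < δ ∧ ∀ (n : ℕ) (V : X d → ℝ), (∀ p, -lam ≤ V p) → (∀ p, V p ≤ Lam) →
      ∀ (b₀ : X d) (M : ℝ) (f : X d → ℝ), (∀ p, blk n p ≠ b₀ → f p = 0) → (∀ p, |f p| ≤ M) →
      ∀ (u : X d → ℝ) (Bu : ℝ), (∀ p, |u p| ≤ Bu) →
      (∀ p, ((n : ℝ) + 1) ^ 2 * ∑ μ, (2 * u p - u (p + e μ) - u (p - e μ))
        + a / ((n : ℝ) + 1) ^ d * ∑ q ∈ B n (blk n p), u q + V p * u p = f p) →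
      ∀ (p : X d) (μ : Fin d),
        exp (δ * ∑ i, (((blk n p i - b₀ i).natAbs : ℕ) : ℝ)) * (((n : ℝ) + 1) * |u (p + e μ) - u p|) ≤ C * M := by
  classical
  obtain ⟨C, δ, hC, hδ, H156⟩ := gradient_decay_road (d := d) hd a ha hlam hLam one_pos
  refine ⟨C, δ, hC, hδ, ?_⟩
  intro n V hV hV' b₀ M f hf hfM u Bu huB hu p μ
  have hm0 : 0 < min 2 a - lam := by linarith
  have hM : 0 ≤ M := (abs_nonneg _).trans (hfM 0)
  choose useq husol using fun k : ℕ => action_surjective n a (3 ^ k) ha.le hm0 (fun x => V (windowMap d ((n + 1) * 3 ^ k) x))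
    (fun x => hV _) (fun x => f (windowMap d ((n + 1) * 3 ^ k) x))
  have hlim := bounded_solution_is_tower_limit hd a ha hlam hLam n V hV hV' f hfM u huB hu useq husol
  -- the window reading of the block source has the torus profile of rate `1` about `σ b₀` (indeed every rate)
  have hprof : ∀ (k : ℕ) (x : Site d ((n + 1) * 3 ^ k)), |f (windowMap d ((n + 1) * 3 ^ k) x)|
      ≤ M * exp (-(1 * ∑ i, ((((siteOf d (3 ^ k) (blk n (windowMap d ((n + 1) * 3 ^ k) x))) i
        - (siteOf d (3 ^ k) b₀) i).valMinAbs.natAbs : ℕ) : ℝ))) := by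
    intro k x
    by_cases hb : blk n (windowMap d ((n + 1) * 3 ^ k) x) = b₀
    · rw [hb, (SupTorusBlockDistance.isPseudoDist_torus (d := d) (3 ^ k)).zero, mul_zero, neg_zero, exp_zero, mul_one]; exact hfM _
    · rw [hf _ hb, abs_zero]; positivity
  have hk : ∀ k : ℕ, exp (δ * ∑ i, ((((siteOf d (3 ^ k) (blk n (windowMap d ((n + 1) * 3 ^ k) (siteOf d ((n + 1) * 3 ^ k) p)))) i
      - (siteOf d (3 ^ k) b₀) i).valMinAbs.natAbs : ℕ) : ℝ))
      * (((n : ℝ) + 1) * |useq k (siteOf d ((n + 1) * 3 ^ k) (p + e μ)) - useq k (siteOf d ((n + 1) * 3 ^ k) p)|) ≤ C * M := by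
    intro k
    rw [siteOf_add]
    exact H156 n (3 ^ k) (fun x => V (windowMap d ((n + 1) * 3 ^ k) x)) (fun x => hV _) (fun x => hV' _) (siteOf d (3 ^ k) b₀) M (useq k)
      (fun x => f (windowMap d ((n + 1) * 3 ^ k) x)) (hprof k) (husol k) _ μ
  set R : ℕ := ∑ i, (blk n p i - b₀ i).natAbs with hR
  have hev : ∀ᶠ k in atTop, exp (δ * ∑ i, (((blk n p i - b₀ i).natAbs : ℕ) : ℝ))
      * (((n : ℝ) + 1) * |useq k (siteOf d ((n + 1) * 3 ^ k) (p + e μ)) - useq k (siteOf d ((n + 1) * 3 ^ k) p)|) ≤ C * M := by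
    refine Filter.eventually_atTop.2 ⟨2 * R + 1, fun k hk' => ?_⟩
    have hlt : ∀ i, 2 * (blk n p i - b₀ i).natAbs < 3 ^ k := fun i => by
      have h1 : (blk n p i - b₀ i).natAbs ≤ R :=
        Finset.single_le_sum (f := fun j => (blk n p j - b₀ j).natAbs) (fun _ _ => Nat.zero_le _) (Finset.mem_univ i)
      have h2 : k < 3 ^ k := Nat.lt_pow_self (by norm_num)
      omega
    have h := hk k
    rw [blockOf_siteOf n (3 ^ k) p, torusDist_eq_l1_of_lt (3 ^ k) (blk n p) b₀ hlt] at h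
    exact h
  exact le_of_tendsto ((((hlim (p + e μ)).sub (hlim p)).abs.const_mul _).const_mul _) hev

/-! ## §3. The bounded `ℤ^d` propagator is `ℓ^∞`-Lipschitz in the potential -/

/-- **HEADLINE (Lipschitz, `ℓ^∞`) — `|u₁ p − u₂ p| ≤ C·‖V₁ − V₂‖_∞·‖f‖_∞` FOR BOUNDED SOLUTIONS OF `H_{V₁}u₁ = f = H_{V₂}u₂` ON `ℤ^d`**, every
`V₁, V₂ : ℤ^d → [−λ, Λ]`, every `|f| ≤ M`, `d ≥ 3`, every mesh: `u₂` IS (180)'s bounded solution (`|u₂| ≤ C₀M`), `u₁ − u₂` solves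
`H_{V₁}w = −(V₁ − V₂)u₂` (size `D·C₀M`) and IS (180)'s bounded solution for that source ((181) twice). [folklore] -/
theorem zd_solution_lipschitz_potential (hd : 3 ≤ d) (a : ℝ) (ha : 0 < a) {lam Lam : ℝ} (hlam : lam < min 2 a) (hLam : 0 ≤ Lam) :
    ∃ C : ℝ, 0 < C ∧ ∀ (n : ℕ) (V₁ V₂ : X d → ℝ), (∀ p, -lam ≤ V₁ p) → (∀ p, V₁ p ≤ Lam) →
      (∀ p, -lam ≤ V₂ p) → (∀ p, V₂ p ≤ Lam) → ∀ D : ℝ, (∀ p, |V₁ p - V₂ p| ≤ D) →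
      ∀ (M : ℝ) (f : X d → ℝ), (∀ p, |f p| ≤ M) →
      ∀ (u₁ u₂ : X d → ℝ) (B₁ B₂ : ℝ), (∀ p, |u₁ p| ≤ B₁) → (∀ p, |u₂ p| ≤ B₂) →
      (∀ p, ((n : ℝ) + 1) ^ 2 * ∑ μ, (2 * u₁ p - u₁ (p + e μ) - u₁ (p - e μ))
        + a / ((n : ℝ) + 1) ^ d * ∑ q ∈ B n (blk n p), u₁ q + V₁ p * u₁ p = f p) →
      (∀ p, ((n : ℝ) + 1) ^ 2 * ∑ μ, (2 * u₂ p - u₂ (p + e μ) - u₂ (p - e μ))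
        + a / ((n : ℝ) + 1) ^ d * ∑ q ∈ B n (blk n p), u₂ q + V₂ p * u₂ p = f p) →
      ∀ p : X d, |u₁ p - u₂ p| ≤ C * D * M := by
  classical
  obtain ⟨C₀, hC₀, H180⟩ := zd_solution_exists (d := d) hd a ha hlam hLam
  refine ⟨C₀ * C₀, by positivity, ?_⟩
  intro n V₁ V₂ hV₁ hV₁' hV₂ hV₂' D hD M f hfM u₁ u₂ B₁ B₂ hu₁B hu₂B hu₁ hu₂ p
  have hM : 0 ≤ M := (abs_nonneg _).trans (hfM 0)
  have hD0 : 0 ≤ D := (abs_nonneg _).trans (hD 0)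
  -- `u₂` is (180)'s bounded solution
  obtain ⟨v₂, hv₂eq, hv₂B⟩ := H180 n V₂ hV₂ hV₂' M f hfM
  have hu₂v₂ : u₂ = v₂ := zd_bounded_solution_unique hd a ha hlam hLam n V₂ hV₂ hV₂' f u₂ v₂ hu₂B hv₂B hu₂ hv₂eq
  -- the difference solves `H_{V₁}w = −(V₁ − V₂)u₂`
  set g : X d → ℝ := fun q => -((V₁ q - V₂ q) * u₂ q) with hg
  have hgM : ∀ q, |g q| ≤ D * (C₀ * M) := fun q => by
    simp only [hg, abs_neg, abs_mul]
    have h2 : |u₂ q| ≤ C₀ * M := by rw [hu₂v₂]; exact hv₂B q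
    exact mul_le_mul (hD q) h2 (abs_nonneg _) hD0
  have hw : ∀ q, ((n : ℝ) + 1) ^ 2 * ∑ μ, (2 * (u₁ q - u₂ q) - (u₁ (q + e μ) - u₂ (q + e μ)) - (u₁ (q - e μ) - u₂ (q - e μ)))
      + a / ((n : ℝ) + 1) ^ d * ∑ q' ∈ B n (blk n q), (u₁ q' - u₂ q') + V₁ q * (u₁ q - u₂ q) = g q := by
    intro q
    have e1 : ∑ μ, (2 * (u₁ q - u₂ q) - (u₁ (q + e μ) - u₂ (q + e μ)) - (u₁ (q - e μ) - u₂ (q - e μ)))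
        = ∑ μ, (2 * u₁ q - u₁ (q + e μ) - u₁ (q - e μ)) - ∑ μ, (2 * u₂ q - u₂ (q + e μ) - u₂ (q - e μ)) := by
      rw [← Finset.sum_sub_distrib]; exact Finset.sum_congr rfl fun μ _ => by ring
    rw [e1, Finset.sum_sub_distrib (f := u₁) (g := u₂)]
    have h1 := hu₁ q
    have h2 := hu₂ q
    simp only [hg]
    linarith
  obtain ⟨w', hw'eq, hw'B⟩ := H180 n V₁ hV₁ hV₁' (D * (C₀ * M)) g hgM
  have hww' : (fun q => u₁ q - u₂ q) = w' :=
    zd_bounded_solution_unique hd a ha hlam hLam n V₁ hV₁ hV₁' g (fun q => u₁ q - u₂ q) w' (B₁ := B₁ + B₂)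
      (fun q => (abs_sub _ _).trans (add_le_add (hu₁B q) (hu₂B q))) hw'B hw hw'eq
  have h := hw'B p
  rw [← hww'] at h
  calc |u₁ p - u₂ p| ≤ C₀ * (D * (C₀ * M)) := h
    _ = C₀ * C₀ * D * M := by ring

/-! ## §4. Toy -/

/-- Toy (`d = 3`, `a = 1`, `λ = 0`, `Λ = 1`): the constants of the `ℤ^d` gradient decay exist. -/
example : ∃ C δ : ℝ, 0 < C ∧ 0 < δ :=
  let ⟨C, δ, hC, hδ, _⟩ := zd_gradient_decay (d := 3) le_rfl 1 one_pos (lam := 0) (Lam := 1)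
    (by rw [min_eq_right (by norm_num : (1 : ℝ) ≤ 2)]; norm_num) zero_le_one
  ⟨C, δ, hC, hδ⟩

end Summit.QuantumFields.BalabanUV.T4Continuum.NE7b.SupZdPropagatorRegularity
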